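import Literature.Geometry.Lorentzian.NearKerrLeaf
import HarnessLib

/-!
# Stub `stub_pinning` of line `Sketch` of crux `Capture` (stmt-FinalStateConjecture-10115):
# label pinning over the compact window

The crux `Capture` (routes `BartnikGapSettling` / `QuietWindowCapture`, summit
`FinalStateConjecture`) assumes that a maximal globally hyperbolic development `𝒟` has, for EVERY
regularity `k`, tolerance `ε > 0` and compact `K ⊆ 𝒟`, an `(ε, k)`-near-Kerr leaf `S`
(`CauchyDevelopment.IsNearKerrLeaf`) beyond `J⁻(K)`.  Once the first normal-form step of the
line's skeleton has fixed the hole count `N`, the labels `(Mᵢ, aᵢ)` of all these leaves lie in the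
window `W = {(M, a) | ∀ i, m₀ ≤ Mᵢ ≤ m₀⁻¹ ∧ |aᵢ| ≤ χ Mᵢ}`.  This file proves the second
normal-form step (`theorem stub_pinning`, verbatim the registered stub of
`Summits/FinalStateConjecture/FinalStateConjecture/Cruxes/Capture/Lines/Sketch.lean`): ONE label
`(M₀, a₀) ∈ W` is approached, to every accuracy `η > 0`, by the labels of leaves at every
`(k, ε, K)`.

Proof (compactness of the window + monotonicity).  `W ⊆ (Fin N → ℝ) × (Fin N → ℝ)` is compact:
closed (finitely many closed conditions) and contained in the compact box
`[m₀, m₀⁻¹]^N × [-B, B]^N`, `B = |χ| · max |m₀| |m₀⁻¹|` (`isCompact_window`).  By contradiction,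
if every `c ∈ W` failed, choose for each `c` an accuracy `η_c > 0` and a witness
`(k_c, ε_c > 0, K_c compact)` admitting NO leaf beyond `J⁻(K_c)` with labels `η_c`-close to `c`.
The open balls `ball c η_c` (sup distance) cover `W`; extract a finite subcover indexed by `t`.
Apply the hypothesis at the common refinement `k' := t.sup k`, `ε' := t.inf ε > 0` (a finite
infimum of positive extended reals is positive), `K' := ⋃_{c ∈ t} K_c` (compact): it returns a
leaf with labels `(M, a) ∈ W`, hence in some `ball c η_c` with `c ∈ t`, so that
`|Mᵢ - c.1 i|, |aᵢ - c.2 i| ≤ dist (M, a) c < η_c`, disjoint from `J⁻(K') ⊇ J⁻(K_c)` (`J⁻` is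
monotone in the set, `causalPast_mono`), and an `(ε', k')`-leaf is an `(ε_c, k_c)`-leaf
(`CauchyDevelopment.IsNearKerrLeaf.mono`) — contradicting the witness at `c`.  (If `W = ∅` the
subcover is empty and the leaf returned at `(k', ε', K') = (0, ⊤, ∅)` has labels in `W = ∅`: the
same contradiction, no separate case.)  No named facts are used; no definitions are introduced.

References: Dafermos–Holzegel–Rodnianski–Taylor arXiv:2104.08222, §1 (the leaf vocabulary);
O'Neill 1983, Ch. 14 (monotonicity of causal pasts).
-/

-- the doubled `FinalStateConjecture.FinalStateConjecture` path component trips dupNamespace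
set_option linter.dupNamespace false

noncomputable section

namespace Summit.FinalStateConjecture.FinalStateConjecture.Theorems.BartnikGapSettling.Capture

open Set Filter Topology
open scoped Manifold ContDiff ENNReal
open Literature.Geometry.Lorentzian

/-- `J⁻` is monotone in the set: `S ⊆ T → J⁻(S) ⊆ J⁻(T)` (the causal past is the causal future for
the reversed time orientation, and `J⁺` is monotone, `LorentzianMetric.causalFuture_mono`).
O'Neill 1983, Ch. 14, p. 403. [folklore] -/
private theorem causalPast_mono (𝓢 : Spacetime 4) {S T : Set 𝓢.carrier} (h : S ⊆ T) :
    𝓢.metric.causalPast 𝓢.timeOrientation S ⊆ 𝓢.metric.causalPast 𝓢.timeOrientation T := by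
  unfold LorentzianMetric.causalPast
  exact LorentzianMetric.causalFuture_mono h

/-- The label window `{(M, a) | ∀ i, m₀ ≤ Mᵢ ≤ m₀⁻¹ ∧ |aᵢ| ≤ χ Mᵢ}` of `N`-hole labels is compact:
it is closed (finitely many closed conditions in the continuous coordinates) and lies in the
compact box `[m₀, m₀⁻¹]^N × [-B, B]^N`, `B = |χ| · max |m₀| |m₀⁻¹|`, since
`|aᵢ| ≤ χ Mᵢ ≤ |χ| |Mᵢ| ≤ |χ| · max |m₀| |m₀⁻¹|` for `m₀ ≤ Mᵢ ≤ m₀⁻¹`. [folklore] -/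
private theorem isCompact_window (N : ℕ) (m₀ χ : ℝ) :
    IsCompact {p : (Fin N → ℝ) × (Fin N → ℝ) |
      ∀ i, m₀ ≤ p.1 i ∧ p.1 i ≤ m₀⁻¹ ∧ |p.2 i| ≤ χ * p.1 i} := by
  have h1 : ∀ i : Fin N, Continuous fun p : (Fin N → ℝ) × (Fin N → ℝ) => p.1 i := fun i =>
    (continuous_apply i).comp continuous_fst
  have h2 : ∀ i : Fin N, Continuous fun p : (Fin N → ℝ) × (Fin N → ℝ) => p.2 i := fun i =>
    (continuous_apply i).comp continuous_snd
  have hclosed : IsClosed {p : (Fin N → ℝ) × (Fin N → ℝ) |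
      ∀ i, m₀ ≤ p.1 i ∧ p.1 i ≤ m₀⁻¹ ∧ |p.2 i| ≤ χ * p.1 i} := by
    simp only [setOf_forall, setOf_and]
    exact isClosed_iInter fun i => (isClosed_le continuous_const (h1 i)).inter
      ((isClosed_le (h1 i) continuous_const).inter
        (isClosed_le (h2 i).abs (continuous_const.mul (h1 i))))
  have hbox : IsCompact ((univ.pi fun _ : Fin N => Icc m₀ m₀⁻¹) ×ˢ
      (univ.pi fun _ : Fin N => Icc (-(|χ| * max |m₀| |m₀⁻¹|)) (|χ| * max |m₀| |m₀⁻¹|))) :=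
    (isCompact_univ_pi fun _ => isCompact_Icc).prod (isCompact_univ_pi fun _ => isCompact_Icc)
  refine hbox.of_isClosed_subset hclosed fun p hp => ?_
  have hp : ∀ i, m₀ ≤ p.1 i ∧ p.1 i ≤ m₀⁻¹ ∧ |p.2 i| ≤ χ * p.1 i := hp
  refine mem_prod.2 ⟨mem_univ_pi.2 fun i => mem_Icc.2 ⟨(hp i).1, (hp i).2.1⟩,
    mem_univ_pi.2 fun i => mem_Icc.2 (abs_le.1 ?_)⟩
  calc |p.2 i| ≤ χ * p.1 i := (hp i).2.2
    _ ≤ |χ * p.1 i| := le_abs_self _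
    _ = |χ| * |p.1 i| := abs_mul _ _
    _ ≤ |χ| * max |m₀| |m₀⁻¹| :=
      mul_le_mul_of_nonneg_left (abs_le_max_abs_abs (hp i).1 (hp i).2.1) (abs_nonneg _)

/-- **Label pinning over the compact window** (stub `stub_pinning` of line `Sketch`, crux
`Capture`, stmt-FinalStateConjecture-10115): if for every `(k, ε > 0, K compact)` the development
`𝒟` has an `N`-hole `(ε, k)`-near-Kerr leaf beyond `J⁻(K)` with labels in the window
`m₀ ≤ Mᵢ ≤ m₀⁻¹`, `|aᵢ| ≤ χ Mᵢ`, then ONE label `(M₀, a₀)` in the window is approached, to every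
accuracy `η > 0`, by the labels of such leaves at every `(k, ε, K)`.  Finite subcover of the
compact window by the balls of the failing accuracies, the common refinement of the finitely many
witnesses, monotonicity of `IsNearKerrLeaf` in `(k, ε)` and of `J⁻` in the set. [folklore] -/
theorem stub_pinning :
    ∀ (X : Type) [TopologicalSpace X] [ChartedSpace E3 X] [IsManifold (𝓡 3) ∞ X] [ConnectedSpace X]
      (D : InitialDataSet (𝓡 3) X) (𝒟 : VacuumCauchyDevelopment D) (N : ℕ) (m₀ χ : ℝ),
      (∀ (k : ℕ) (ε : ℝ≥0∞), 0 < ε → ∀ K : Set 𝒟.carrier, IsCompact K →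
        ∃ (M a : Fin N → ℝ) (S : Set 𝒟.carrier),
          (∀ i, m₀ ≤ M i ∧ M i ≤ m₀⁻¹ ∧ |a i| ≤ χ * M i) ∧
            Disjoint S (𝒟.metric.causalPast 𝒟.timeOrientation K) ∧
              𝒟.toCauchyDevelopment.IsNearKerrLeaf k ε N M a S) →
      ∃ (M₀ a₀ : Fin N → ℝ), (∀ i, m₀ ≤ M₀ i ∧ M₀ i ≤ m₀⁻¹ ∧ |a₀ i| ≤ χ * M₀ i) ∧
        ∀ η : ℝ, 0 < η → ∀ (k : ℕ) (ε : ℝ≥0∞), 0 < ε → ∀ K : Set 𝒟.carrier, IsCompact K →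
          ∃ (M a : Fin N → ℝ) (S : Set 𝒟.carrier), (∀ i, |M i - M₀ i| ≤ η ∧ |a i - a₀ i| ≤ η) ∧
            Disjoint S (𝒟.metric.causalPast 𝒟.timeOrientation K) ∧
              𝒟.toCauchyDevelopment.IsNearKerrLeaf k ε N M a S := by
  intro X _ _ _ _ D 𝒟 N m₀ χ H
  by_contra hcon
  push Not at hcon
  -- the label window `W`: an opaque compact set together with its membership interface
  obtain ⟨W, hW, hWc⟩ : ∃ W : Set ((Fin N → ℝ) × (Fin N → ℝ)),
      (∀ p, p ∈ W ↔ ∀ i, m₀ ≤ p.1 i ∧ p.1 i ≤ m₀⁻¹ ∧ |p.2 i| ≤ χ * p.1 i) ∧ IsCompact W :=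
    ⟨_, fun _ => Iff.rfl, isCompact_window N m₀ χ⟩
  -- for each label `c ∈ W`: an accuracy `η c > 0` and a witness `(k c, ε c > 0, K c compact)`
  -- admitting NO leaf beyond `J⁻(K c)` with labels `η c`-close to `c`
  choose η hη k ε hε K hK hno using fun c : W => hcon c.1.1 c.1.2 ((hW c.1).1 c.2)
  -- a finite subcover `t` of the cover of the compact window by the balls `ball c (η c)`
  obtain ⟨t, ht⟩ := hWc.elim_finite_subcover (fun c : W => Metric.ball c.1 (η c))
    (fun _ => Metric.isOpen_ball) fun p hp => mem_iUnion.2 ⟨⟨p, hp⟩, Metric.mem_ball_self (hη _)⟩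
  -- the common refinement `(k', ε', K') := (t.sup k, t.inf ε, ⋃ c ∈ t, K c)` of the witnesses
  have hε' : 0 < t.inf ε := (Finset.lt_inf_iff ENNReal.zero_lt_top).2 fun c _ => hε c
  obtain ⟨M, a, S, hwin, hdisj, hleaf⟩ :=
    H (t.sup k) (t.inf ε) hε' (⋃ c ∈ t, K c) (t.isCompact_biUnion fun c _ => hK c)
  -- the returned labels lie in the window, hence in a ball `ball c (η c)` of the subcover
  obtain ⟨c, hc, hball⟩ := mem_iUnion₂.1 (ht ((hW (M, a)).2 hwin))
  rw [Metric.mem_ball, Prod.dist_eq, max_lt_iff] at hball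
  have hM : ∀ i, |M i - c.1.1 i| ≤ η c := fun i => by
    rw [← Real.dist_eq]
    exact ((dist_le_pi_dist M c.1.1 i).trans_lt hball.1).le
  have ha : ∀ i, |a i - c.1.2 i| ≤ η c := fun i => by
    rw [← Real.dist_eq]
    exact ((dist_le_pi_dist a c.1.2 i).trans_lt hball.2).le
  -- the returned leaf is admissible for the witness at `c`: contradiction
  have hKc : K c ⊆ ⋃ c' ∈ t, K c' := t.subset_set_biUnion_of_mem hc
  have hkc : k c ≤ t.sup k := Finset.le_sup hc
  have hεc : t.inf ε ≤ ε c := Finset.inf_le hc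
  exact hno c M a S (fun i => ⟨hM i, ha i⟩)
    (hdisj.mono_right (causalPast_mono 𝒟.toSpacetime hKc)) (hleaf.mono hkc hεc)

end Summit.FinalStateConjecture.FinalStateConjecture.Theorems.BartnikGapSettling.Capture
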